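import Summits.ResolutionOfSingularities.ResolutionOfSingularities.Theorems.WeightedInvariantE2SpanHomogeneous
import Summits.ResolutionOfSingularities.ResolutionOfSingularities.Theorems.WeightedInvariantE2SpanContraction
import Summits.ResolutionOfSingularities.ResolutionOfSingularities.Theorems.WeightedInvariantE2HomogeneousChartDefs
import Summits.ResolutionOfSingularities.ResolutionOfSingularities.Theorems.WeightedInvariantE2SmoothLocalization
import Summits.ResolutionOfSingularities.ResolutionOfSingularities.Theorems.WeightedInvariantOrbitOrderHomogeneousCore
import Summits.ResolutionOfSingularities.ResolutionOfSingularities.Theorems.WeightedInvariantOrbitCentreHomogeneousBaseChange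
import Literature.AlgebraicGeometry.Resolution.CobordantBlowupExtReesBridge
import HarnessLib

/-!
# E2 centre, (G-0-U) `E2HomogeneousSpanBody`, part 3b: THE HOMOGENEOUS-SPAN PRESENTATION from the plain (open″)≤3 body and the
# homogeneity of the contracted `J`-pieces

[OURS · L1 W4.3 · DOOR `HypersurfaceCentreConstruction` stmt-ResolutionOfSingularities-19897 · E2 tier, centre piece (C-c), hand
(G-0-U) = board (o47-c-U) `E2HomogeneousSpanBody p ι J` (registrar res-L1-w43-plan-1, SPEC (Δ11) rev 9/10, words landed by res-L1-s36-pv-1 as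
`…E2HomogeneousChartDefs`); res-D-pv-031 (gen 11).  Glue over parts 1–3a; nothing here is a statement of the manuscript under adjudication
[Hironaka2017]; candidate-design support, AI-written, weaker than expert review.]

* `jOpenBodyLE3HomU_of_jOpenBodyLE3` — at a prime `𝔪` of a Noetherian `ℤʲ`-graded ring with `dim A_𝔪 ≤ 3`: the plain body
  `JOpenLE3.JOpenBodyLE3 ι J A 𝔪 F` together with (U-a) «every contraction `A ∩ J(A_𝔪, F)ₘ` is homogeneous» gives
  `JOpenBodyLE3HomU 𝒜 ι J 𝔪 F` (homogeneous `U'` by part 2 (U-b), new localising element `h · s` by part 2 (U-c); the iff/`J` clauses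
  transfer because `V(U') = V(U)` and `𝒥(U', W) = 𝒥(U, W)` stalkwise on `D(h s)`).
* `e2HomogeneousSpan_of_homContraction` — `PRungGrHomLE 3 p ι J` + (U-a) at every graded model position ⇒ `E2HomogeneousSpanBody p ι J`.
* `isHomogeneous_comap_J` — **(U-a)**: under the rung, at a HOMOGENEOUS prime `𝔪` with `A_𝔪` regular of dimension `≤ 3` and for
  HOMOGENEOUS `F`, every contraction `A ∩ J(A_𝔪, F)ₘ` is homogeneous: part 3a's kernel fed with the TWIST-STABILITY
  `J(A_𝔪, F)ₘ · B` (along `ρ`) `= J(A_𝔪, F)ₘ · B` (along `ι₀`), `B = A[ℤʲ]_{𝔪 A[ℤʲ]}`, which is (c11)≤3 read along the two smooth legs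
  `ι₀, ρ : A → A[ℤʲ]` (res-L1-s36-pv-1's `E2Model.iotaJ_localization_eq_of_smooth`, regular ascent
  `E2Model.isRegularLocalRing_localization_of_map_eq`, dimension `OrbitCentreHomogeneous.ringKrullDim_eq_of_isLocalization_atPrime_map`)
  plus `JUnitInvariant` (`ρ F = [deg F] · ι₀ F`).
* `e2HomogeneousSpan` — **the DEALT TARGET: `PRungGrHomLE 3 p ι J → E2HomogeneousSpanBody p ι J`** (the `hU` input of the registrar's
  `E2HomogeneousChartBody_of_homU`; `p.Prime` and the graded-simplicity hypothesis are not used).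
-/

set_option linter.dupNamespace false -- mandated namespace of this single-conjunct summit

noncomputable section

open IsLocalRing Literature.AlgebraicGeometry.Resolution
open Summit.ResolutionOfSingularities.ResolutionOfSingularities.Theorems

namespace Summit.ResolutionOfSingularities.ResolutionOfSingularities.Cruxes.HypersurfaceCentreConstruction.LocalEngine

namespace E2Span

/-- **Plain body + homogeneous contractions ⇒ homogeneous-span body.** [OURS] -/
theorem jOpenBodyLE3HomU_of_jOpenBodyLE3 {A : Type} [CommRing A] [IsNoetherianRing A] {j : ℕ}
    (𝒜 : (Fin j → ℤ) → AddSubgroup A) [GradedRing 𝒜]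
    (ι : (R : Type) → [CommRing R] → R → Ordinal.{0}) (J : (R : Type) → [CommRing R] → R → ℕ → Ideal R)
    (𝔪 : Ideal A) [𝔪.IsPrime] (F : A) (hdim : ringKrullDim (Localization.AtPrime 𝔪) ≤ (3 : ℕ))
    (hhomJ : ∀ m : ℕ, ((J (Localization.AtPrime 𝔪) (algebraMap A (Localization.AtPrime 𝔪) F) m).comap
      (algebraMap A (Localization.AtPrime 𝔪))).IsHomogeneous 𝒜)
    (hbody : JOpenLE3.JOpenBodyLE3 ι J A 𝔪 F) : JOpenBodyLE3HomU 𝒜 ι J 𝔪 F := by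
  obtain ⟨h, hh, N, U, W, hW, ⟨hU, hli⟩, hcl⟩ := hbody
  have hU𝔪 : ∀ i, U i ∈ 𝔪 := fun i =>
    (IsLocalization.AtPrime.to_map_mem_maximal_iff (Localization.AtPrime 𝔪) 𝔪 (U i)).mp (hU i)
  have hJ𝔪 := (hcl 𝔪 hh hdim).2 hU𝔪
  -- (U-a) in the form part 2 wants
  have hhom : ∀ l, (((weightedFiltration (fun i => algebraMap A (Localization.AtPrime 𝔪) (U i)) W).ideal (W l)).comap
      (algebraMap A (Localization.AtPrime 𝔪))).IsHomogeneous 𝒜 := by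
    intro l
    have e : (weightedFiltration (fun i => algebraMap A (Localization.AtPrime 𝔪) (U i)) W).ideal (W l) =
        J (Localization.AtPrime 𝔪) (algebraMap A (Localization.AtPrime 𝔪) F) (W l) := by
      rw [hJ𝔪, weightedMonomialIdeal_eq_weightedFiltration_ideal, map_weightedFiltration_ideal]; rfl
    rw [e]; exact hhomJ (W l)
  obtain ⟨U', hU'hom, hfil, hU', hli'⟩ := exists_isHomogeneousElem_ideal_eq 𝒜 𝔪 U W hW hU hli hhom
  obtain ⟨s, hs, hsp⟩ := exists_not_mem_forall_ideal_eq_of_eq 𝔪 U W U' W hW hW hfil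
  refine ⟨h * s, fun hmem => ((‹𝔪.IsPrime›).mem_or_mem hmem).elim hh hs, N, U', W, hW, hU'hom, ⟨hU', hli'⟩,
    fun 𝔮 _ hq hdimq => ?_⟩
  have hhq : h ∉ 𝔮 := fun h' => hq (Ideal.mul_mem_right _ _ h')
  have hsq : s ∉ 𝔮 := fun h' => hq (Ideal.mul_mem_left _ _ h')
  obtain ⟨hiff, heq⟩ := hsp 𝔮 hsq
  obtain ⟨hcl1, hcl2⟩ := hcl 𝔮 hhq hdimq
  refine ⟨hiff.trans hcl1, fun hU'q m => ?_⟩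
  rw [hcl2 (hiff.mp hU'q) m, weightedMonomialIdeal_eq_weightedFiltration_ideal,
    weightedMonomialIdeal_eq_weightedFiltration_ideal, map_weightedFiltration_ideal, map_weightedFiltration_ideal]
  exact (heq m).symm

/-- **`PRungGrHomLE 3 p ι J` + (U-a) ⇒ `E2HomogeneousSpanBody p ι J`.**  (U-a) — the homogeneity of the contracted pieces
`A ∩ J(A_𝔪, F)ₘ` at every graded model position — is part 3a `isHomogeneous_comap_of_map_le'` applied to the twist-stability of
`J(A_𝔪, F)ₘ` (res-L1-s36-pv-1's `E2Model.J_map_localization_homogeneousCore_eq`, (c11)≤3 + `JUnitInvariant`). [OURS] -/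
theorem e2HomogeneousSpan_of_homContraction {p : ℕ} {ι : (R : Type) → [CommRing R] → R → Ordinal.{0}}
    {J : (R : Type) → [CommRing R] → R → ℕ → Ideal R} (hr : PRungGrHomLE 3 p ι J)
    (hUa : ∀ (k₀ : Type) [Field k₀] [CharP k₀ p] [PerfectField k₀]
      (A : Type) [CommRing A] [Algebra k₀ A] [Algebra.FiniteType k₀ A]
      (j : ℕ) (𝒜 : (Fin j → ℤ) → AddSubgroup A) [GradedRing 𝒜],
      (∀ c : k₀, algebraMap k₀ A c ∈ 𝒜 0) →
      ∀ (𝔪 : Ideal A) [𝔪.IsPrime] (F : A), 𝔪.IsHomogeneous 𝒜 → SetLike.IsHomogeneousElem 𝒜 F →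
      IsRegularLocalRing (Localization.AtPrime 𝔪) → ringKrullDim (Localization.AtPrime 𝔪) ≤ (3 : ℕ) →
      ∀ m : ℕ, ((J (Localization.AtPrime 𝔪) (algebraMap A (Localization.AtPrime 𝔪) F) m).comap
        (algebraMap A (Localization.AtPrime 𝔪))).IsHomogeneous 𝒜) :
    E2HomogeneousSpanBody p ι J := by
  intro k₀ _ _ _ A _ _ _ j 𝒜 _ h0 𝔪 _ F h𝔪 _hgs hF hreg hdim hF0 hF2
  haveI : IsNoetherianRing A := Algebra.FiniteType.isNoetherianRing k₀ A
  exact jOpenBodyLE3HomU_of_jOpenBodyLE3 𝒜 ι J 𝔪 F hdim (hUa k₀ A j 𝒜 h0 𝔪 F h𝔪 hF hreg hdim)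
    (jOpenBodyLE3_of_pRungGrHomLE hr k₀ A 𝔪 F hreg hdim hF0 hF2)

/-! ## (U-a) The contracted `J`-pieces at a homogeneous prime are homogeneous -/

open AddMonoidAlgebra
open Summit.ResolutionOfSingularities.ResolutionOfSingularities.Theorems.DatumToEmbedded.CentreHomogeneous
open Summit.ResolutionOfSingularities.ResolutionOfSingularities.Theorems.OrbitCentreHomogeneous

/-- **(U-a).**  Under the graded HOM rung at `d = 3`: for `A` Noetherian and `ℤʲ`-graded, a HOMOGENEOUS prime `𝔪` with `A_𝔪` regular
of dimension `≤ 3` and a HOMOGENEOUS `F`, every contraction `A ∩ J(A_𝔪, F)ₘ` is a homogeneous ideal of `A`.  Twist-stability at the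
generic torus point `B = A[ℤʲ]_{𝔪 A[ℤʲ]}` from (c11)≤3 along the smooth legs `ι₀, ρ` and `JUnitInvariant`; then part 3a. [OURS] -/
theorem isHomogeneous_comap_J {p : ℕ} {ι : (R : Type) → [CommRing R] → R → Ordinal.{0}}
    {J : (R : Type) → [CommRing R] → R → ℕ → Ideal R} (hr : PRungGrHomLE 3 p ι J)
    {A : Type} [CommRing A] [IsNoetherianRing A] {j : ℕ} (𝒜 : (Fin j → ℤ) → AddSubgroup A) [GradedRing 𝒜]
    (𝔪 : Ideal A) [𝔪.IsPrime] (F : A) (h𝔪 : 𝔪.IsHomogeneous 𝒜) (hF : SetLike.IsHomogeneousElem 𝒜 F)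
    (hreg : IsRegularLocalRing (Localization.AtPrime 𝔪)) (hdim : ringKrullDim (Localization.AtPrime 𝔪) ≤ (3 : ℕ))
    (m : ℕ) :
    ((J (Localization.AtPrime 𝔪) (algebraMap A (Localization.AtPrime 𝔪) F) m).comap
      (algebraMap A (Localization.AtPrime 𝔪))).IsHomogeneous 𝒜 := by
  classical
  obtain ⟨ρ, hρ⟩ := exists_coaction 𝒜
  set ι₀ : A →+* A[Fin j → ℤ] := singleZeroRingHom with hι₀
  set 𝔓 : Ideal A[Fin j → ℤ] := 𝔪.map ι₀ with h𝔓def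
  haveI h𝔓 : 𝔓.IsPrime := isPrime_map_singleZeroRingHom 𝔪
  have h1 : 𝔪 = 𝔓.comap ι₀ := (comap_map_singleZeroRingHom 𝔪).symm
  have h2 : 𝔪 = 𝔓.comap ρ := (OrbitOrder.comap_coaction_map_eq_self_of_isHomogeneous 𝒜 ρ hρ h𝔪).symm
  haveI : IsNoetherianRing A[Fin j → ℤ] := Algebra.FiniteType.isNoetherianRing A _
  haveI := hreg
  haveI hregB : IsRegularLocalRing (Localization.AtPrime 𝔓) :=
    E2Model.isRegularLocalRing_localization_of_map_eq ι₀ 𝔓 𝔪 h1 (smooth_singleZeroRingHom A j) rfl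
  have hdimB : ringKrullDim (Localization.AtPrime 𝔓) ≤ (3 : ℕ) := by
    rw [ringKrullDim_eq_of_isLocalization_atPrime_map 𝔪 (Localization.AtPrime 𝔪) 𝔓 rfl (Localization.AtPrime 𝔓)]
    exact hdim
  have hc11 : IotaJEssSmoothCompatibleLE 3 ι J := hr.1.2.2.2.2.2.1
  have hJU : JUnitInvariant J := hr.1.2.2.2.2.2.2.2.2.2
  obtain ⟨-, hJ₁⟩ := E2Model.iotaJ_localization_eq_of_smooth ι₀ 𝔓 𝔪 h1 hc11 (smooth_singleZeroRingHom A j) hdimB F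
  obtain ⟨-, hJ₂⟩ := E2Model.iotaJ_localization_eq_of_smooth ρ 𝔓 𝔪 h2 hc11 (smooth_coaction 𝒜 ρ hρ) hdimB F
  -- `ρ F = [deg F] · ι₀ F`, a unit multiple
  obtain ⟨d, hd⟩ := hF
  have hρF : ρ F = single d (1 : A) * ι₀ F := by
    rw [hρ d F hd, hι₀, singleZeroRingHom_eq, single_mul_single, add_zero, one_mul]
  have hunit : IsUnit (algebraMap A[Fin j → ℤ] (Localization.AtPrime 𝔓) (single d (1 : A))) := by
    refine (IsUnit.of_mul_eq_one (single (-d) (1 : A)) ?_).map _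
    rw [single_mul_single, add_neg_cancel, one_mul, AddMonoidAlgebra.one_def]
  have hJeq : J (Localization.AtPrime 𝔓) (algebraMap _ (Localization.AtPrime 𝔓) (ρ F)) m =
      J (Localization.AtPrime 𝔓) (algebraMap _ (Localization.AtPrime 𝔓) (ι₀ F)) m := by
    rw [hρF, map_mul]
    exact hJU _ _ _ m hunit
  refine isHomogeneous_comap_of_map_le' 𝒜 ρ hρ 𝔪 (Localization.AtPrime 𝔪) 𝔓 rfl (Localization.AtPrime 𝔓)
    (Localization.localRingHom 𝔪 𝔓 ι₀ h1) (Localization.localRingHom 𝔪 𝔓 ρ h2) ?_ ?_ _ ?_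
  · ext a; exact Localization.localRingHom_to_map 𝔪 𝔓 ι₀ h1 a
  · ext a; exact Localization.localRingHom_to_map 𝔪 𝔓 ρ h2 a
  · rw [← hJ₂, ← hJ₁, hJeq]

end E2Span

/-- **(G-0-U) `E2HomogeneousSpanBody p ι J` UNDER THE GRADED HOM RUNG** — the DEALT TARGET (res-L1-w43-plan-1 DEAL 19:50:17Z): the
`hU` input of `E2HomogeneousChartBody_of_homU` (…E2HomogeneousChartDefs).  `p.Prime` and graded-simplicity of `A ⧸ 𝔪` are idle. [OURS] -/
theorem e2HomogeneousSpan (p : ℕ) (_hp : p.Prime) (ι : (R : Type) → [CommRing R] → R → Ordinal.{0})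
    (J : (R : Type) → [CommRing R] → R → ℕ → Ideal R) : PRungGrHomLE 3 p ι J → E2HomogeneousSpanBody p ι J :=
  fun hr => E2Span.e2HomogeneousSpan_of_homContraction hr
    fun k₀ _ _ _ A _ _ _ _ 𝒜 _ _ 𝔪 _ F h𝔪 hF hreg hdim m =>
      haveI : IsNoetherianRing A := Algebra.FiniteType.isNoetherianRing k₀ A
      E2Span.isHomogeneous_comap_J hr 𝒜 𝔪 F h𝔪 hF hreg hdim m


end Summit.ResolutionOfSingularities.ResolutionOfSingularities.Cruxes.HypersurfaceCentreConstruction.LocalEngine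

end
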